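import Literature.Topology.FourManifolds.FlowerSectorRetraction
import Literature.Topology.FourManifolds.FlowerValleyArc
import HarnessLib

/-!
# The explicit retraction of a sector of the flower surface onto its reduced spine

Topic `Literature/Topology/FourManifolds`; sequel of `FlowerSectorRetraction.lean` for the fact
seat `provefact-Literature.Topology.FourManifolds.exists-cbed50d78a` (named fact (g′)
`Literature.Topology.FourManifolds.exists_marking_centralSurface_of_gkTrisection`).  The strong
deformation retraction of the sector `sectorZ g` onto its reduced spine `spineZ'` is only a
`Prop`; to compute words in `π₁` (via `RetractionInclusionFormula.inclHomOfSubset_fromPath_map_retraction`)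
one needs an explicit continuous retraction.  Here it is:

* `endMap hg = whisker₁ ∘ (lift of the axis slide at time 1) ∘ (lift of the wedge squeeze at time 1)`,
  `endMap_mem` (into `spineZ'`), `endMap_eq_self` (fixes `spineZ'`), `continuousOn_endMap`,
  packaged as `retr hg : C(sectorZ g, spineZ' g hg)` with `retr_inclusion`;
* §3 its values on the valley ray `θ = π/g` (the boundary arc of the sector): the inner part
  (`ρ ≤ ρ₁`) goes to the pinch point `I` (`endMap_valley_inner`), the lens part (`ρ₁ ≤ ρ ≤ 7^{1/20g}`)
  onto the upper lens branch (`endMap_valley_lens`), the middle part (`7^{1/20g} ≤ ρ ≤ ρ₃`) onto the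
  branch of `C₁` of the same sheet (`endMap_valley_mid`), the outer part (`ρ₃ ≤ ρ ≤ ρ₄`) to `Q`
  (`endMap_valley_outer`); and on the inner axis segment (`endMap_axis_inner`);
* §4 `endMap_refl3` — the end map commutes with the mirror symmetry `y ↦ -y` of the sector.

Everything is proved; no named facts.

## References

* A. Hatcher, *Algebraic Topology*, CUP (2002), Prop. 1.17 and Example 1.22. [HatcherAT2002]
-/

open scoped Manifold ContDiff Topology InnerProductSpace Real unitInterval
open Set Function Filter Metric Module Complex

noncomputable section

namespace Literature.Topology.FourManifolds

/-- Local notation: `𝔼 n` is the model Euclidean space `EuclideanSpace ℝ (Fin n)`. -/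
local notation "𝔼 " n:arg => EuclideanSpace ℝ (Fin n)

open PlanarThickening PlanarDouble Literature.AlgebraicTopology.Homotopy

namespace FlowerModel

variable {g : ℕ}

/-! ### §1 Continuity of a lifted map -/

/-- **A lifted planar map is continuous on the double** when the planar map is continuous on
`W ⊆ {q ≤ c}` and maps seam points to seam points. [folklore] -/
theorem continuousOn_liftMap {q : 𝔼 2 → ℝ} {c : ℝ} (hq : Continuous q) {W : Set (𝔼 2)} {ψ : 𝔼 2 → 𝔼 2}
    (hψ : ContinuousOn ψ W) (hseam : ∀ u ∈ W, q u = c → q (ψ u) = c) :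
    ContinuousOn (liftMap q c ψ) (double q c ∩ proj ⁻¹' W) := by
  have hφ : ContinuousOn (fun p : 𝔼 3 => ψ (proj p)) (double q c ∩ proj ⁻¹' W) :=
    hψ.comp proj.continuous.continuousOn fun p hp => hp.2
  have hroot : ContinuousOn (fun p : 𝔼 3 => Real.sqrt (c - q (ψ (proj p)))) (double q c ∩ proj ⁻¹' W) :=
    Real.continuous_sqrt.comp_continuousOn (continuousOn_const.sub (hq.comp_continuousOn hφ))
  have hz : ContinuousOn (fun p : 𝔼 3 => p 2) (double q c ∩ proj ⁻¹' W) :=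
    (EuclideanSpace.proj (2 : Fin 3)).continuous.continuousOn
  have hscal := continuousOn_sign_mul hz hroot (by
    rintro p ⟨hp, hpW⟩ h2
    simp only at h2 ⊢
    have hs : q (proj p) = c := (apply_two_eq_zero_iff hp).1 h2
    rw [hseam _ hpW hs, sub_self, Real.sqrt_zero])
  unfold liftMap
  exact (lift.continuous.comp_continuousOn hφ).add (hscal.smul continuousOn_const)

/-! ### §2 The end map of the sector deformation -/

/-- The first stage: the lift of the wedge squeeze at time `1`. [folklore] -/
def stage1 (g : ℕ) (p : 𝔼 3) : 𝔼 3 := liftMap (flower g) (level g) (sqzW g 1) p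

/-- The second stage: the lift of the axis slide at time `1`. [folklore] -/
def stage2 (hg : 2 ≤ g) (p : 𝔼 3) : 𝔼 3 := liftMap (flower g) (level g) (slide hg 1) p

/-- **The end map** `r = whisker₁ ∘ (lift of slide₁) ∘ (lift of sqzW₁)` of the three-stage
deformation of the sector: an explicit retraction of the sector onto the reduced spine. [folklore] -/
def endMap (hg : 2 ≤ g) (p : 𝔼 3) : 𝔼 3 := whisker hg 1 (stage2 hg (stage1 g p))

/-- The first stage maps the sector into the part of the surface over the floor set. [folklore] -/
theorem stage1_mem (hg : 2 ≤ g) {p : 𝔼 3} (hp : p ∈ sectorZ g) : stage1 g p ∈ floorZ g hg := by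
  have h1 : (1 : ℝ) ∈ Icc (0 : ℝ) 1 := ⟨zero_le_one, le_rfl⟩
  refine ⟨liftMap_mem' hp.1 ?_ ?_, ?_⟩
  · exact (sqzW_mem_wedge hg h1 hp.2).1
  · intro hq
    have := sqzW_eq_self_of_mem_floorSetW hg 1 (mem_floorSetW_of_seam hg hp.2 hq)
    rw [this]; exact hq
  · show proj (stage1 g p) ∈ floorSetW g hg
    rw [stage1, proj_liftMap]; exact sqzW_one_mem hg hp.2

/-- The second stage maps the part over the floor set into the spine. [folklore] -/
theorem stage2_mem (hg : 2 ≤ g) {p : 𝔼 3} (hp : p ∈ floorZ g hg) : stage2 hg p ∈ spineZ g hg := by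
  refine ⟨liftMap_mem' hp.1 ?_ ?_, ?_⟩
  · exact (floorSetW_subset_wedge hg (slide_mem hg ⟨zero_le_one, le_rfl⟩ hp.2)).1
  · intro hq
    rw [slide_eq_self_of_seam hg 1 hp.2 hq]; exact hq
  · show proj (stage2 hg p) ∈ spineFloor g hg
    rw [stage2, proj_liftMap]; exact slide_one_mem hg hp.2

/-- **The end map sends the sector into the reduced spine.** [folklore] -/
theorem endMap_mem (hg : 2 ≤ g) {p : 𝔼 3} (hp : p ∈ sectorZ g) : endMap hg p ∈ spineZ' g hg :=
  whisker_one_mem hg (stage2_mem hg (stage1_mem hg hp))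

/-- The first stage fixes the part over the floor set. [folklore] -/
theorem stage1_eq_self (hg : 2 ≤ g) {p : 𝔼 3} (hp : p ∈ floorZ g hg) : stage1 g p = p :=
  liftMap_eq_self hp.1 (sqzW_eq_self_of_mem_floorSetW hg 1 hp.2)

/-- The second stage fixes the spine. [folklore] -/
theorem stage2_eq_self (hg : 2 ≤ g) {p : 𝔼 3} (hp : p ∈ spineZ g hg) : stage2 hg p = p :=
  liftMap_eq_self hp.1 (slide_eq_self_of_mem_spineFloor hg 1 hp.2)

/-- The spine lies over the floor set; the reduced spine lies in the spine. [folklore] -/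
theorem spineZ_subset_floorZ (hg : 2 ≤ g) : spineZ g hg ⊆ floorZ g hg := fun _ hp => ⟨hp.1, spineFloor_subset hg hp.2⟩

/-- **The end map fixes the reduced spine.** [folklore] -/
theorem endMap_eq_self (hg : 2 ≤ g) {p : 𝔼 3} (hp : p ∈ spineZ' g hg) : endMap hg p = p := by
  rw [endMap, stage1_eq_self hg (spineZ_subset_floorZ hg hp.1), stage2_eq_self hg hp.1, whisker_eq_self hg 1 hp]

/-- **The end map is continuous on the sector.** [folklore] -/
theorem continuousOn_endMap (hg : 2 ≤ g) : ContinuousOn (endMap hg) (sectorZ g) := by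
  have h1 : (1 : ℝ) ∈ Icc (0 : ℝ) 1 := ⟨zero_le_one, le_rfl⟩
  have hi2 : Continuous fun u : 𝔼 2 => ((1 : ℝ), u) := continuous_const.prodMk continuous_id
  have hi3 : Continuous fun p : 𝔼 3 => ((1 : ℝ), p) := continuous_const.prodMk continuous_id
  have hsq : ContinuousOn (sqzW g 1) (wedge g) := by
    have h := (continuousOn_sqzW hg).comp hi2.continuousOn (fun u hu => ⟨mem_univ _, hu⟩)
    exact h
  have hsl : ContinuousOn (slide hg 1) (floorSetW g hg) := by
    have h := (continuousOn_slide hg).comp hi2.continuousOn (fun u hu => ⟨mem_univ _, hu⟩)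
    exact h
  have hs3 : ContinuousOn (whisker hg 1) (spineZ g hg) := by
    have h := (continuousOn_whisker hg).comp hi3.continuousOn (fun p hp => ⟨h1, hp⟩)
    exact h
  have hs1 : ContinuousOn (stage1 g) (sectorZ g) := by
    have h := continuousOn_liftMap (contDiff_flower (g := g)).continuous hsq (fun u hu hq => by
      rw [sqzW_eq_self_of_mem_floorSetW hg 1 (mem_floorSetW_of_seam hg hu hq)]; exact hq)
    exact h
  have hs2 : ContinuousOn (stage2 hg) (floorZ g hg) := by
    have h := continuousOn_liftMap (contDiff_flower (g := g)).continuous hsl (fun u hu hq => by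
      rw [slide_eq_self_of_seam hg 1 hu hq]; exact hq)
    exact h
  have h12 : ContinuousOn (fun p => stage2 hg (stage1 g p)) (sectorZ g) :=
    hs2.comp hs1 fun p hp => stage1_mem hg hp
  exact hs3.comp h12 fun p hp => stage2_mem hg (stage1_mem hg hp)

/-- **The end map as a continuous retraction of the sector onto its reduced spine.** [folklore] -/
def retr (hg : 2 ≤ g) : C(↥(sectorZ g), ↥(spineZ' g hg)) :=
  ⟨fun p => ⟨endMap hg p, endMap_mem hg p.2⟩,
    ((continuousOn_endMap hg).comp_continuous continuous_subtype_val fun p => p.2).subtype_mk _⟩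

/-- The retraction fixes the reduced spine. [folklore] -/
theorem retr_inclusion (hg : 2 ≤ g) (h : spineZ' g hg ⊆ sectorZ g) (a : ↥(spineZ' g hg)) :
    retr hg (ContinuousMap.inclusion h a) = a :=
  Subtype.ext (endMap_eq_self hg a.2)

/-! ### §3 Values of the end map -/

/-- **The inner pinch point** `I = (ρ₁, 0, 0)`. [folklore] -/
def ptI (hg : 2 ≤ g) : 𝔼 3 := lift (ax (rho1 hg))

/-- The lift of a point whose image under `ψ` is a seam point has height `0`. [folklore] -/
theorem liftMap_of_seam_image {q : 𝔼 2 → ℝ} {c : ℝ} {ψ : 𝔼 2 → 𝔼 2} {p : 𝔼 3} (h : q (ψ (proj p)) = c) :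
    liftMap q c ψ p = lift (ψ (proj p)) := by
  rw [liftMap, h, sub_self, Real.sqrt_zero, mul_zero, zero_smul, add_zero]

/-- The lift of a positive-height point stays on the upper sheet. [folklore] -/
theorem liftMap_of_pos {q : 𝔼 2 → ℝ} {c : ℝ} {ψ : 𝔼 2 → 𝔼 2} {p : 𝔼 3} (h : 0 < p 2) :
    liftMap q c ψ p = upperPt q c (ψ (proj p)) := by
  rw [liftMap, Real.sign_of_pos h, one_mul, upperPt]

/-- The lift of a negative-height point stays on the lower sheet. [folklore] -/
theorem liftMap_of_neg {q : 𝔼 2 → ℝ} {c : ℝ} {ψ : 𝔼 2 → 𝔼 2} {p : 𝔼 3} (h : p 2 < 0) :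
    liftMap q c ψ p = lowerPt q c (ψ (proj p)) := by
  rw [liftMap, Real.sign_of_neg h, neg_one_mul, lowerPt]

/-- `f(ρ₁) = c`: the inner pinch point is a seam point. [folklore] -/
theorem flower_ax_rho1 (hg : 2 ≤ g) : flower g (ax (rho1 hg)) = level g := by rw [flower_ax', prof_rho1 hg]

/-- The squeeze at time `1` of a valley ray point is the floor point below it. [folklore] -/
theorem sqzW_one_valley (hg : 2 ≤ g) {ρ : ℝ} (hρ : 0 < ρ) : sqzW g 1 (pol ρ (π / g)) = pol ρ (thlo g ρ) := by
  have hg' : (2 : ℝ) ≤ g := by exact_mod_cast hg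
  have hπg : π / g ≤ π / 2 := div_le_div_of_nonneg_left Real.pi_pos.le two_pos hg'
  have him : 0 ≤ (toC (pol ρ (π / g))).im := by
    rw [im_toC_pol]; exact mul_nonneg hρ.le (Real.sin_nonneg_of_nonneg_of_le_pi (by positivity) (by linarith [Real.pi_pos]))
  rw [sqzW_of_im_nonneg 1 him, sqz_pol 1 hρ ⟨by linarith [Real.pi_pos, show 0 < π / g by positivity], by linarith [Real.pi_pos]⟩]
  congr 1; ring

/-- The axis slide at time `1` on a floor point of radius `≤ ρ₁` gives the pinch point. [folklore] -/
theorem slide_one_of_le (hg : 2 ≤ g) {u : 𝔼 2} (hu : ‖u‖ ≤ rho1 hg) : slide hg 1 u = ax (rho1 hg) := by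
  rw [slide, if_pos hu, one_mul, add_sub_cancel]

/-- The axis slide at time `1` on a point of radius `> ρ₁` is the identity. [folklore] -/
theorem slide_one_of_lt (hg : 2 ≤ g) {u : 𝔼 2} (hu : rho1 hg < ‖u‖) : slide hg 1 u = u := by
  rw [slide, if_neg (not_le.2 hu)]

/-- **The end map on the inner part of a valley ray** (radius `ρ ≤ ρ₁`, either sheet): the inner
pinch point `I`. [folklore] -/
theorem endMap_valley_inner (hg : 2 ≤ g) {p : 𝔼 3} {ρ : ℝ} (hρ0 : 0 ≤ ρ) (hρ : ρ ≤ rho1 hg)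
    (hπ : proj p = pol ρ (π / g)) : endMap hg p = ptI hg := by
  -- stage 1
  have hs1 : proj (stage1 g p) = pol ρ (thlo g ρ) := by
    rw [stage1, proj_liftMap, hπ]
    rcases hρ0.eq_or_lt with h | h
    · rw [← h, pol_zero_left, pol_zero_left]
      have : sqzW g 1 (0 : 𝔼 2) = sqz g 1 0 := sqzW_of_im_nonneg 1 (by simp)
      rw [this, sqz_zero]
    · exact sqzW_one_valley hg h
  have hn1 : ‖proj (stage1 g p)‖ ≤ rho1 hg := by rw [hs1, norm_pol, abs_of_nonneg hρ0]; exact hρ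
  -- stage 2: seam image, so height `0`
  have hs2 : stage2 hg (stage1 g p) = ptI hg := by
    rw [stage2, liftMap_of_seam_image (by rw [slide_one_of_le hg hn1, flower_ax_rho1 hg]), slide_one_of_le hg hn1, ptI]
  have hI : ptI hg ∈ spineZ' g hg := by
    refine ⟨⟨lift_mem_flowerSurface (flower_ax_rho1 hg), ?_⟩, ?_⟩
    · show proj (lift (ax (rho1 hg))) ∈ spineFloor g hg
      rw [proj_lift]
      exact Or.inl ⟨rho1 hg, ⟨le_rfl, (rho1_lt_rho4 hg).le⟩, pol_thlo_eq_ax hg (rho1_pos hg).le le_rfl⟩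
    · show ‖proj (lift (ax (rho1 hg)))‖ ≤ rho3 hg
      rw [proj_lift, norm_ax, abs_of_pos (rho1_pos hg)]; exact rho1_le_rho3 hg
  rw [endMap, hs2, whisker_eq_self hg 1 hI]

/-- **The end map on the lens part of a valley ray** (`ρ₁ ≤ ρ ≤ 7^{1/20g}`, either sheet): the lens
seam point `(pol ρ (θ_lo ρ), 0)`. [folklore] -/
theorem endMap_valley_lens (hg : 2 ≤ g) {p : 𝔼 3} {ρ : ℝ} (hρ1 : rho1 hg ≤ ρ) (hρ7 : ρ ≤ rt g 7)
    (hπ : proj p = pol ρ (π / g)) : endMap hg p = lift (pol ρ (thlo g ρ)) := by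
  have hρ0 : 0 < ρ := lt_of_lt_of_le (rho1_pos hg) hρ1
  have hseam : flower g (pol ρ (thlo g ρ)) = level g :=
    (flower_pol_thlo_eq_level_iff hg hρ0 (le_trans hρ7 (rt_seven_lt_rho4 hg).le)).2
      ((level_le_prof_iff hg hρ0.le).2 (Or.inl ⟨hρ1, hρ7⟩))
  have hs1 : stage1 g p = lift (pol ρ (thlo g ρ)) := by
    rw [stage1, liftMap_of_seam_image (by rw [hπ, sqzW_one_valley hg hρ0, hseam]), hπ, sqzW_one_valley hg hρ0]
  have hmem : lift (pol ρ (thlo g ρ)) ∈ spineZ' g hg := by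
    refine ⟨⟨lift_mem_flowerSurface hseam, ?_⟩, ?_⟩
    · show proj (lift (pol ρ (thlo g ρ))) ∈ spineFloor g hg
      rw [proj_lift]; exact Or.inl ⟨ρ, ⟨hρ1, le_trans hρ7 (rt_seven_lt_rho4 hg).le⟩, rfl⟩
    · show ‖proj (lift (pol ρ (thlo g ρ)))‖ ≤ rho3 hg
      rw [proj_lift, norm_pol, abs_of_pos hρ0]; exact le_trans hρ7 (rt_seven_lt_rho3 hg).le
  rw [endMap, hs1, stage2_eq_self hg hmem.1, whisker_eq_self hg 1 hmem]

/-- The height of a point of the surface over a valley ray point of radius `< ρ₄` is non-zero. [folklore] -/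
theorem apply_two_ne_zero_of_valley (hg : 2 ≤ g) {p : 𝔼 3} (hp : p ∈ flowerSurface g) {ρ : ℝ} (hρ0 : 0 ≤ ρ)
    (hρ : ρ < rho4 hg) (hπ : proj p = pol ρ (π / g)) : p 2 ≠ 0 := by
  intro h0
  have hq := (apply_two_eq_zero_iff hp).1 h0
  rw [hπ, flower_pol_valley (by omega)] at hq
  exact hρ.ne ((vprof_eq_level_iff hg hρ0).1 hq)

/-- **The end map on the outer spine part of a valley ray** (`7^{1/20g} ≤ ρ ≤ ρ₃`): the point of the
same sheet over the axis point `(ρ, 0)`. [folklore] -/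
theorem endMap_valley_mid (hg : 2 ≤ g) {p : 𝔼 3} (hp : p ∈ sectorZ g) {ρ : ℝ} (hρ7 : rt g 7 ≤ ρ) (hρ3 : ρ ≤ rho3 hg)
    (hπ : proj p = pol ρ (π / g)) :
    endMap hg p = (if 0 ≤ p 2 then upperPt (flower g) (level g) (ax ρ) else lowerPt (flower g) (level g) (ax ρ)) := by
  have hρ0 : 0 < ρ := lt_of_lt_of_le (rt_pos (by norm_num)) hρ7
  have hρ1 : rho1 hg < ρ := lt_of_lt_of_le (rho1_lt_rt_seven hg) hρ7
  have h2 : p 2 ≠ 0 := apply_two_ne_zero_of_valley hg hp.1 hρ0.le (lt_of_le_of_lt hρ3 (rho3_lt_rho4 hg)) hπ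
  have hfloor : sqzW g 1 (proj p) = ax ρ := by rw [hπ, sqzW_one_valley hg hρ0, thlo_eq_zero_of_mem hg hρ7 hρ3, pol_zero_right]
  have hle : flower g (ax ρ) ≤ level g := by
    rw [flower_ax']; exact (prof_le_level_iff hg hρ0.le).2 (Or.inr ⟨hρ7, hρ3⟩)
  -- the image point of the same sheet over `(ρ, 0)` lies in the reduced spine
  have hmemU : upperPt (flower g) (level g) (ax ρ) ∈ spineZ' g hg ∧ lowerPt (flower g) (level g) (ax ρ) ∈ spineZ' g hg := by
    have hfl : ax ρ ∈ spineFloor g hg :=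
      Or.inl ⟨ρ, ⟨hρ1.le, le_trans hρ3 (rho3_lt_rho4 hg).le⟩, by
        show pol ρ (thlo g ρ) = ax ρ
        rw [thlo_eq_zero_of_mem hg hρ7 hρ3, pol_zero_right]⟩
    have hn : ‖ax ρ‖ ≤ rho3 hg := by rw [norm_ax, abs_of_pos hρ0]; exact hρ3
    refine ⟨⟨⟨upperPt_mem hle, ?_⟩, ?_⟩, ⟨⟨lowerPt_mem hle, ?_⟩, ?_⟩⟩
    · show proj (upperPt (flower g) (level g) (ax ρ)) ∈ spineFloor g hg
      rw [proj_upperPt]; exact hfl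
    · show ‖proj (upperPt (flower g) (level g) (ax ρ))‖ ≤ rho3 hg
      rw [proj_upperPt]; exact hn
    · show proj (lowerPt (flower g) (level g) (ax ρ)) ∈ spineFloor g hg
      rw [proj_lowerPt]; exact hfl
    · show ‖proj (lowerPt (flower g) (level g) (ax ρ))‖ ≤ rho3 hg
      rw [proj_lowerPt]; exact hn
  rcases lt_or_gt_of_ne h2 with hneg | hpos
  · rw [if_neg (not_le.2 hneg)]
    have hs1 : stage1 g p = lowerPt (flower g) (level g) (ax ρ) := by rw [stage1, liftMap_of_neg hneg, hfloor]
    rw [endMap, hs1, stage2_eq_self hg hmemU.2.1, whisker_eq_self hg 1 hmemU.2]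
  · rw [if_pos hpos.le]
    have hs1 : stage1 g p = upperPt (flower g) (level g) (ax ρ) := by rw [stage1, liftMap_of_pos hpos, hfloor]
    rw [endMap, hs1, stage2_eq_self hg hmemU.1.1, whisker_eq_self hg 1 hmemU.1]

/-- **The end map on the whisker part of a valley ray** (`ρ₃ ≤ ρ ≤ ρ₄`): the indentation point `Q`. [folklore] -/
theorem endMap_valley_outer (hg : 2 ≤ g) {p : 𝔼 3} {ρ : ℝ} (hρ3 : rho3 hg ≤ ρ) (hρ4 : ρ ≤ rho4 hg)
    (hπ : proj p = pol ρ (π / g)) : endMap hg p = ptQ hg := by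
  have hρ0 : 0 < ρ := lt_of_lt_of_le (rho3_pos hg) hρ3
  have hseam : flower g (pol ρ (thlo g ρ)) = level g := flower_pol_thlo_eq_of_rho3_le hg hρ3 hρ4
  have hs1 : stage1 g p = lift (pol ρ (thlo g ρ)) := by
    rw [stage1, liftMap_of_seam_image (by rw [hπ, sqzW_one_valley hg hρ0, hseam]), hπ, sqzW_one_valley hg hρ0]
  have hmem : lift (pol ρ (thlo g ρ)) ∈ spineZ g hg := (lift_pol_thlo_mem_spineZ hg hρ3 hρ4).1
  rw [endMap, hs1, stage2_eq_self hg hmem, whisker, proj_lift, norm_pol, abs_of_pos hρ0, if_pos hρ3]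
  have hw : whiskerRadius hg 1 (lift (pol ρ (thlo g ρ))) = rho3 hg := by rw [whiskerRadius]; ring
  have him : 0 ≤ (toC (pol ρ (thlo g ρ))).im := by
    rw [im_toC_pol]; exact mul_nonneg hρ0.le (sin_thlo_nonneg (by omega) ρ)
  rw [if_pos him, hw, thlo_eq_zero_of_mem hg (rt_seven_lt_rho3 hg).le le_rfl, pol_zero_right, ptQ]

/-- **The end map on the upper axis segment** (`(r, 0, +)`, `0 ≤ r ≤ ρ₁`): the inner pinch point. [folklore] -/
theorem endMap_axis_inner (hg : 2 ≤ g) {p : 𝔼 3} {r : ℝ} (hr0 : 0 ≤ r) (hr : r ≤ rho1 hg)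
    (hπ : proj p = ax r) : endMap hg p = ptI hg := by
  have hfix : sqzW g 1 (proj p) = ax r := by
    rw [hπ]
    have hax : ax r ∈ floorSetW g hg := ax_mem_floorSetW hg hr0 hr
    exact sqzW_eq_self_of_mem_floorSetW hg 1 hax
  have hn1 : ‖proj (stage1 g p)‖ ≤ rho1 hg := by rw [stage1, proj_liftMap, hfix, norm_ax, abs_of_nonneg hr0]; exact hr
  have hs2 : stage2 hg (stage1 g p) = ptI hg := by
    rw [stage2, liftMap_of_seam_image (by rw [slide_one_of_le hg hn1, flower_ax_rho1 hg]), slide_one_of_le hg hn1, ptI]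
  have hI : ptI hg ∈ spineZ' g hg := by
    refine ⟨⟨lift_mem_flowerSurface (flower_ax_rho1 hg), ?_⟩, ?_⟩
    · show proj (lift (ax (rho1 hg))) ∈ spineFloor g hg
      rw [proj_lift]
      exact Or.inl ⟨rho1 hg, ⟨le_rfl, (rho1_lt_rho4 hg).le⟩, pol_thlo_eq_ax hg (rho1_pos hg).le le_rfl⟩
    · show ‖proj (lift (ax (rho1 hg)))‖ ≤ rho3 hg
      rw [proj_lift, norm_ax, abs_of_pos (rho1_pos hg)]; exact rho1_le_rho3 hg
  rw [endMap, hs2, whisker_eq_self hg 1 hI]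

/-! ### §4 Mirror symmetry of the end map -/

/-- The squeeze commutes with the reflection (on the wedge). [folklore] -/
theorem sqzW_one_refl (hg : 2 ≤ g) {u : 𝔼 2} (hu : u ∈ wedge g) : sqzW g 1 (refl u) = refl (sqzW g 1 u) := sqzW_refl hg 1 hu

/-- The axis slide commutes with the reflection. [folklore] -/
theorem slide_refl (hg : 2 ≤ g) (t : ℝ) (u : 𝔼 2) : slide hg t (refl u) = refl (slide hg t u) := by
  unfold slide
  rw [norm_refl]
  split_ifs
  · rw [refl_ax]
  · rfl

/-- The lift of a map commuting with the reflection commutes with the lifted reflection. [folklore] -/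
theorem liftMap_refl3 {q : 𝔼 2 → ℝ} {c : ℝ} (hq : ∀ u, q (refl u) = q u) {ψ : 𝔼 2 → 𝔼 2} (p : 𝔼 3)
    (hψ : ψ (refl (proj p)) = refl (ψ (proj p))) : liftMap q c ψ (refl3 p) = refl3 (liftMap q c ψ p) := by
  rw [liftMap, liftMap, proj_refl3, refl3_apply_two, hψ, hq, refl3_apply, map_add, map_smul, proj_lift, proj_ez,
    smul_zero, add_zero]
  simp

/-- The whisker collapse commutes with the lifted reflection. [folklore] -/
theorem whisker_refl3 (hg : 2 ≤ g) (s : ℝ) {p : 𝔼 3} (hp : p ∈ spineZ g hg) : whisker hg s (refl3 p) = refl3 (whisker hg s p) := by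
  have hw : whiskerRadius hg s (refl3 p) = whiskerRadius hg s p := by rw [whiskerRadius, whiskerRadius, proj_refl3, norm_refl]
  unfold whisker
  rw [proj_refl3, norm_refl, hw, im_toC_refl]
  by_cases h3 : rho3 hg ≤ ‖proj p‖
  · rw [if_pos h3, if_pos h3]
    rcases lt_trichotomy (toC (proj p)).im 0 with hlt | heq | hgt
    · rw [if_pos (by linarith), if_neg (not_le.2 hlt), refl3_lift, refl_pol, neg_neg]
    · -- on the axis the point is `Q` and everything agrees
      have hQ := eq_ptQ_of_mem_spineZ hg hp h3 heq
      have hw' : whiskerRadius hg s p = rho3 hg := by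
        rw [whiskerRadius, hQ, ptQ, proj_lift, norm_ax, abs_of_pos (rho3_pos hg)]; ring
      rw [heq, neg_zero, if_pos le_rfl, hw', thlo_eq_zero_of_mem hg (rt_seven_lt_rho3 hg).le le_rfl,
        pol_zero_right, refl3_lift, refl_ax]
    · rw [if_neg (by linarith), if_pos hgt.le, refl3_lift, refl_pol]
  · rw [if_neg h3, if_neg h3]

/-- The sector is symmetric. [folklore] -/
theorem refl3_mem_sectorZ (hg : 2 ≤ g) {p : 𝔼 3} (hp : p ∈ sectorZ g) : refl3 p ∈ sectorZ g := by
  refine ⟨?_, ?_⟩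
  · show thicken (flower g) (refl3 p) = level g
    rw [thicken_flower_refl3]; exact hp.1
  · show proj (refl3 p) ∈ wedge g
    rw [proj_refl3]; exact refl_mem_wedge hg hp.2

/-- **The end map commutes with the mirror symmetry of the sector.** [folklore] -/
theorem endMap_refl3 (hg : 2 ≤ g) {p : 𝔼 3} (hp : p ∈ sectorZ g) : endMap hg (refl3 p) = refl3 (endMap hg p) := by
  have hq : ∀ u : 𝔼 2, flower g (refl u) = flower g u := fun u => flower_refl u
  have h1 : stage1 g (refl3 p) = refl3 (stage1 g p) := liftMap_refl3 hq p (sqzW_one_refl hg hp.2)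
  have h2 : stage2 hg (refl3 (stage1 g p)) = refl3 (stage2 hg (stage1 g p)) :=
    liftMap_refl3 hq _ (slide_refl hg 1 _)
  rw [endMap, h1, h2, whisker_refl3 hg 1 (stage2_mem hg (stage1_mem hg hp)), endMap]

end FlowerModel

end Literature.Topology.FourManifolds
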